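import Summits.SmoothPoincare4.SmoothPoincare4.Theorems.SymplecticOrigamiGromovRecognitionRelEndNoJSpheres

/-!
# `J`-spheres are homologically essential: `⟨[sf], F_*[ℂℙ¹]⟩ ≠ 0` for a non-constant `J`-sphere
(registered helper `helper_jSphereEssential` of line `cross-cap-laurent`, crux `GromovRecognitionRelEnd`,
item stmt-SmoothPoincare4-11009)

The quantitative half of `helper_noJSpheres` (landed, `…NoJSpheres.lean`), isolated for the core's
compactness step (bubbles of the two leaf families carry energy) and for the sister lines: for an
almost complex structure `J` on a 4-manifold `M` tamed by a CLOSED smooth 2-form `sf`, a NON-CONSTANT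
`J`-holomorphic two-chart sphere `(u, v)` glued to `F : ℂℙ¹ → M` pairs non-trivially with the de Rham
class of `sf`: `⟨e_M [sf], F_* ([ℂℙ¹] ⊗ 1)⟩ ≠ 0` (McDuff–Salamon 2017, §4.5 (4.5.4) and Ex. 4.4.5:
`E(u) = ∫ u^*ω = ⟨[ω], [u]⟩ > 0`; here sign-free, for the tree's choice of fundamental class, and
valid for branched, non-immersed spheres — the integral of the energy density is positive as soon as
`du ≠ 0` somewhere). No `π₂` hypothesis. The proof is steps (0)–(7) of `NoJSpheres.noJSpheres`.
-/

noncomputable section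

-- the prescribed namespace `Summit.<P>.<Sub>.…` duplicates `SmoothPoincare4` (P = Sub)
set_option linter.dupNamespace false

open scoped Manifold ContDiff Topology
open Set Function Module TopologicalSpace
open Literature.Geometry.Kaehler Literature.Geometry.Symplectic Literature.Geometry.Manifold
open Literature.Topology.FourManifolds Literature.AlgebraicTopology.SingularHomology
open Literature.Topology.FourManifolds.ComplexProjectiveSpace
open Literature.AlgebraicTopology.Homotopy Literature.NumberTheory.Transcendental

namespace Summit.SmoothPoincare4.SmoothPoincare4.Theorems.GromovRecognitionRelEnd.CrossCapLaurent

/-- **Registered helper `helper_jSphereEssential`: a non-constant `J`-sphere, `J` tamed by a closed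
form, pairs non-trivially with the class of the form** (McDuff–Salamon 2017, §4.5 (4.5.4), Ex. 4.4.5;
sign-free form over the tree's fundamental class of `ℂℙ¹`). [cite: McDuffSalamon2017, §4.5 eq. (4.5.4)] -/
theorem helper_jSphereEssential : ∀ (M : Type) [TopologicalSpace M] [T2Space M] [SecondCountableTopology M] [ChartedSpace (EuclideanSpace ℝ (Fin 4)) M] [IsManifold (𝓡 4) ∞ M] [SigmaCompactSpace M] (sf : Literature.Geometry.Kaehler.MForm (𝓡 4) M ℝ 2) (J : Literature.Geometry.Symplectic.AlmostComplexStructure (𝓡 4) ∞ M) (u v : ℂ → M) (F : Literature.Topology.FourManifolds.ComplexProjectiveSpace 1 → M) (hF : Continuous F) (hs : Literature.Geometry.Kaehler.IsSmoothForm sf) (hc : Literature.Geometry.Kaehler.IsClosedForm sf), J.IsTamedBy sf → ContMDiff 𝓘(ℝ, ℂ) (𝓡 4) ∞ u → ContMDiff 𝓘(ℝ, ℂ) (𝓡 4) ∞ v → (∀ z : ℂ, z ≠ 0 → v z = u z⁻¹) → Literature.Geometry.Symplectic.IsJHolomorphic (𝓡 4) (fun y => J y) u → Literature.Geometry.Symplectic.IsJHolomorphic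 (𝓡 4) (fun y => J y) v → (∀ p, Literature.Topology.FourManifolds.ComplexProjectiveSpace.CoordNeZero 0 p → F p = u (Literature.Topology.FourManifolds.ComplexProjectiveSpace.affineCoordComplex 0 p 0)) → (∀ p, Literature.Topology.FourManifolds.ComplexProjectiveSpace.CoordNeZero 1 p → F p = v (Literature.Topology.FourManifolds.ComplexProjectiveSpace.affineCoordComplex 1 p 0)) → (∃ z : ℂ, u z ≠ u 0) → Literature.AlgebraicTopology.SingularHomology.kroneckerPairing ℝ ℝ M (2 * 1) (Literature.NumberTheory.Transcendental.integrationDeRhamIsoFamily (EuclideanSpace ℝ (Fin 4)) M (2 * 1) (Literature.Geometry.Kaehler.deRhamCohomology.mk ⟨sf, ⟨hs, hc⟩⟩)) (Literature.AlgebraicTopology.SingularHomology.singularHomology.map ℝ ℝ ⟨F, hF⟩ (2 * 1) (Literature.AlgebraicTopology.SingularHomology.singularHomology.coeffChange (Literature.Topology.FourManifolds.ComplexProjectiveSpace 1) (algebraMap ℤ ℝ : ℤ →+* ℝ).toAddMonoidHom (2 * 1) (Literature.Topology.FourManifolds.ComplexProjectiveSpace.homologicalOrientationInt 1).fundamentalClass))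 ≠ 0 := by
  intro M _ _ _ _ _ _ sf J u v F hFc hs hc ht hu hv huv hJu hJv hF0 hF1 hne
  haveI : Fact (finrank ℝ (EuclideanSpace ℝ (Fin (2 * 1))) = 2 * 1) :=
    Fact.mk (@finrank_euclideanSpace_fin ℝ _ (2 * 1))
  haveI : LocallyCompactSpace M := ChartedSpace.locallyCompactSpace (EuclideanSpace ℝ (Fin 4)) M
  -- (0) the complex coordinate `ℓ` of the model plane and its area form `A`
  set ℓ : EuclideanSpace ℝ (Fin (2 * 1)) →L[ℝ] ℂ :=
    (ContinuousLinearMap.proj (R := ℝ) (φ := fun _ : Fin 1 => ℂ) 0).comp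
      ((realCoordinates 1).symm : EuclideanSpace ℝ (Fin (2 * 1)) →L[ℝ] (Fin 1 → ℂ)) with hℓdef
  have hℓ : ∀ a : EuclideanSpace ℝ (Fin (2 * 1)), ((realCoordinates 1).symm a) 0 = ℓ a :=
    fun a => rfl
  have hℓR : ∀ w : Fin 1 → ℂ, ℓ (realCoordinates 1 w) = w 0 := fun w => by simp [hℓdef]
  set A : EuclideanSpace ℝ (Fin (2 * 1)) [⋀^Fin (2 * 1)]→ₗ[ℝ] ℝ :=
    (Complex.basisOneI.det).compLinearMap (ℓ : EuclideanSpace ℝ (Fin (2 * 1)) →L[ℝ] ℂ).toLinearMap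
    with hAdef
  have hAab : ∀ a b : EuclideanSpace ℝ (Fin (2 * 1)),
      A ![a, b] = (ℓ a).re * (ℓ b).im - (ℓ a).im * (ℓ b).re := by
    intro a b
    simp only [hAdef, AlternatingMap.compLinearMap_apply]
    rw [Module.Basis.det_apply, Matrix.det_fin_two]
    simp [Module.Basis.toMatrix_apply, Matrix.cons_val_zero, Matrix.cons_val_one]
    ring
  have hA0 : A ≠ 0 := by
    intro h
    have h1 := congrArg (fun f => f ![realCoordinates 1 ![1], realCoordinates 1 ![Complex.I]]) h
    simp only [hAab, hℓR, AlternatingMap.zero_apply] at h1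
    norm_num [Matrix.cons_val_zero] at h1
  -- (1) a point where `du ≠ 0`
  obtain ⟨z₀, hz₀⟩ := NoJSpheres.exists_mfderiv_ne_zero hu hne
  -- (2) the glued sphere
  have hF : ContMDiff (𝓡 (2 * 1)) (𝓡 4) ∞ F := helper_gluedSphereContMDiff M u v F hu hv hF0 hF1
  -- (3) the pulled back form
  set β : MForm (𝓡 (2 * 1)) (ComplexProjectiveSpace 1) ℝ (2 * 1) := sf.pullback (𝓡 (2 * 1)) F
    with hβdef
  have hsf : sf ∈ closedSmoothForms (𝓡 4) M ℝ 2 := ⟨hs, hc⟩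
  have hβ : β ∈ closedSmoothForms (𝓡 (2 * 1)) (ComplexProjectiveSpace 1) ℝ (2 * 1) :=
    pullback_mem_closedSmoothForms hF hsf
  -- (4) pointwise: `β_p = k_p • A` with `k_p ≥ 0`, and `k_{p₀} > 0` somewhere
  have htame : ∀ (x : M) (e : TangentSpace (𝓡 4) x), 0 ≤ sf x ![e, (fun y => J y) x e] :=
    fun x e => ht.nonneg x e
  have htame' : ∀ (x : M) (e : TangentSpace (𝓡 4) x), e ≠ 0 → 0 < sf x ![e, (fun y => J y) x e] :=
    fun x e he => ht.pos x he
  -- the chart formula for `β`: in the preferred chart `i = chartIndex p`, `β_p(a, b) = Bᵢ(ℓ a, ℓ b)`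
  have hchart : ∀ p : ComplexProjectiveSpace 1, ∃ (w : ℂ → M) (c : ℂ),
      IsJHolomorphic (𝓡 4) (fun y => J y) w ∧
      (∀ a b : EuclideanSpace ℝ (Fin (2 * 1)), β p ![a, b] = (sf.pullback 𝓘(ℝ, ℂ) w) c ![ℓ a, ℓ b]) ∧
      ((chartIndex p = 0 ∧ w = u ∧ c = affineCoordComplex 0 p 0) ∨
        (chartIndex p = 1 ∧ w = v ∧ c = affineCoordComplex 1 p 0)) := by
    intro p
    have hd := helper_gluedSphereMfderiv M u v F hu hv hF0 hF1 p
    rcases Fin.exists_fin_two.1 ⟨chartIndex p, rfl⟩ with h | h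
    · refine ⟨u, affineCoordComplex 0 p 0, hJu, fun a b => ?_, Or.inl ⟨h, rfl, rfl⟩⟩
      have hp0 : CoordNeZero 0 p := by simpa [h] using coordNeZero_chartIndex p
      have hFp : F p = u (affineCoordComplex 0 p 0) := hF0 p hp0
      simp only [hβdef, MForm.pullback_apply, hd.1 h, hℓ]
      rw [hFp]
      congr 1
      funext j
      fin_cases j <;> rfl
    · refine ⟨v, affineCoordComplex 1 p 0, hJv, fun a b => ?_, Or.inr ⟨h, rfl, rfl⟩⟩
      have hp1 : CoordNeZero 1 p := by simpa [h] using coordNeZero_chartIndex p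
      have hFp : F p = v (affineCoordComplex 1 p 0) := hF1 p hp1
      simp only [hβdef, MForm.pullback_apply, hd.2 h, hℓ]
      rw [hFp]
      congr 1
      funext j
      fin_cases j <;> rfl
  have hkey : ∀ p : ComplexProjectiveSpace 1, ∃ k : ℝ, 0 ≤ k ∧
      ∀ a b : EuclideanSpace ℝ (Fin (2 * 1)), β p ![a, b] = k * A ![a, b] := by
    intro p
    obtain ⟨w, c, hJw, hab, -⟩ := hchart p
    refine ⟨(sf.pullback 𝓘(ℝ, ℂ) w) c ![(1 : ℂ), Complex.I], ?_, fun a b => ?_⟩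
    · simpa using hJw.pullback_apply_pair_nonneg htame c 1
    · rw [hab, hAab]
      exact NoJSpheres.planar_apply_eq ((sf.pullback 𝓘(ℝ, ℂ) w) c).toAlternatingMap (ℓ a) (ℓ b)
  have hpos : ∃ p : ComplexProjectiveSpace 1, ∃ k : ℝ, 0 < k ∧
      ∀ a b : EuclideanSpace ℝ (Fin (2 * 1)), β p ![a, b] = k * A ![a, b] := by
    refine ⟨ComplexProjectiveSpace.mk (homogenize 0 fun _ : Fin 1 => z₀), ?_⟩
    obtain ⟨w, c, hJw, hab, hcase⟩ :=
      hchart (ComplexProjectiveSpace.mk (homogenize 0 fun _ : Fin 1 => z₀))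
    refine ⟨(sf.pullback 𝓘(ℝ, ℂ) w) c ![(1 : ℂ), Complex.I], ?_, fun a b => ?_⟩
    · have hdw : mfderiv 𝓘(ℝ, ℂ) (𝓡 4) w c ≠ 0 := by
        rcases hcase with ⟨-, rfl, rfl⟩ | ⟨h1, rfl, rfl⟩
        · rwa [NoJSpheres.affineCoordComplex_zero_pt]
        · rw [NoJSpheres.affineCoordComplex_one_pt]
          have hp1 : CoordNeZero 1 (ComplexProjectiveSpace.mk (homogenize 0 fun _ : Fin 1 => z₀)) := by
            simpa [h1] using
              coordNeZero_chartIndex (ComplexProjectiveSpace.mk (homogenize 0 fun _ : Fin 1 => z₀))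
          exact NoJSpheres.mfderiv_inv_chart_ne_zero hv huv (NoJSpheres.ne_zero_of_coordNeZero_one_pt hp1) hz₀
      simpa using hJw.pullback_apply_pair_pos htame' hdw one_ne_zero
    · rw [hab, hAab]
      exact NoJSpheres.planar_apply_eq ((sf.pullback 𝓘(ℝ, ℂ) w) c).toAlternatingMap (ℓ a) (ℓ b)
  -- (5) the complex orientation (the ray of `A`) and the sign conditions
  set o : (p : ComplexProjectiveSpace 1) →
      Orientation ℝ (TangentSpace (𝓡 (2 * 1)) p) (Fin (2 * 1)) := fun _ => rayOfNeZero ℝ A hA0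
    with hodef
  have ho : IsContinuousOrientation o := helper_projectiveLineOrientation (rayOfNeZero ℝ A hA0)
  set e := modelBasis (EuclideanSpace ℝ (Fin (2 * 1))) (2 * 1) with hedef
  have hsign : ∀ p : ComplexProjectiveSpace 1,
      Real.sign (orientationForm o p ⇑e) = Real.sign (A ⇑e) := fun p =>
    sign_someVector_rayOfNeZero A hA0 ⇑e
  have hAe : A ⇑e ≠ 0 := fun h => hA0 ((AlternatingMap.map_basis_eq_zero_iff e A).1 h)
  have he01 : (⇑e : Fin (2 * 1) → EuclideanSpace ℝ (Fin (2 * 1))) = ![e 0, e 1] := by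
    funext i; fin_cases i <;> rfl
  have h0 : ∀ p : ComplexProjectiveSpace 1, 0 ≤ Real.sign (orientationForm o p ⇑e) *
      (show EuclideanSpace ℝ (Fin (2 * 1)) [⋀^Fin (2 * 1)]→L[ℝ] ℝ from β p) ⇑e := by
    intro p
    obtain ⟨k, hk, hkab⟩ := hkey p
    rw [hsign p, he01]
    change 0 ≤ Real.sign (A ![e 0, e 1]) * β p ![e 0, e 1]
    rw [hkab, mul_left_comm, real_sign_mul_self]
    positivity
  have h1 : ∃ p : ComplexProjectiveSpace 1, 0 < Real.sign (orientationForm o p ⇑e) *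
      (show EuclideanSpace ℝ (Fin (2 * 1)) [⋀^Fin (2 * 1)]→L[ℝ] ℝ from β p) ⇑e := by
    obtain ⟨p, k, hk, hkab⟩ := hpos
    refine ⟨p, ?_⟩
    rw [hsign p, he01]
    change 0 < Real.sign (A ![e 0, e 1]) * β p ![e 0, e 1]
    rw [hkab, mul_left_comm, real_sign_mul_self]
    rw [he01] at hAe
    positivity
  -- (6) `∫ β > 0`, so `β` is not exact and `[β] ≠ 0`, so `⟨e_P [β], [P] ⊗ 1⟩ ≠ 0`
  have hint : 0 < β.integral o := MForm.integral_pos_of_sign_mul_apply_nonneg ho hβ.1 h0 h1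
  have hnex : β ∉ exactSmoothForms (𝓡 (2 * 1)) (ComplexProjectiveSpace 1) ℝ (2 * 1) := fun hex =>
    hint.ne' (MForm.integral_eq_zero_of_mem_exactSmoothForms_holds o ho hex)
  have hmk : deRhamCohomology.mk ⟨β, hβ⟩ ≠ 0 := fun h0' =>
    hnex (mem_exactSmoothForms_of_mk_eq_zero _ h0')
  set μP := ComplexProjectiveSpace.homologicalOrientationInt 1 with hμP
  have heP : integrationDeRhamIsoFamily (EuclideanSpace ℝ (Fin (2 * 1))) (ComplexProjectiveSpace 1)
      (2 * 1) (deRhamCohomology.mk ⟨β, hβ⟩) ≠ 0 :=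
    fun h0' => hmk ((LinearEquiv.map_eq_zero_iff _).1 h0')
  have hpairP : kroneckerPairing ℝ ℝ (ComplexProjectiveSpace 1) (2 * 1)
      (integrationDeRhamIsoFamily (EuclideanSpace ℝ (Fin (2 * 1))) (ComplexProjectiveSpace 1) (2 * 1)
        (deRhamCohomology.mk ⟨β, hβ⟩))
      (singularHomology.coeffChange (ComplexProjectiveSpace 1) (algebraMap ℤ ℝ : ℤ →+* ℝ).toAddMonoidHom
        (2 * 1) μP.fundamentalClass) ≠ 0 :=
    fun h0' => heP (eq_zero_of_kroneckerPairing_coeffChange_fundamentalClass_eq_zero ℝ μP h0')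
  -- (7) naturality: this is `⟨e_M [sf], F_* ([P] ⊗ 1)⟩`, which vanishes since `F_* = 0`
  have hnat : kroneckerPairing ℝ ℝ (ComplexProjectiveSpace 1) (2 * 1)
      (integrationDeRhamIsoFamily (EuclideanSpace ℝ (Fin (2 * 1))) (ComplexProjectiveSpace 1) (2 * 1)
        (deRhamCohomology.mk ⟨β, hβ⟩))
      (singularHomology.coeffChange (ComplexProjectiveSpace 1) (algebraMap ℤ ℝ : ℤ →+* ℝ).toAddMonoidHom
        (2 * 1) μP.fundamentalClass) =
      kroneckerPairing ℝ ℝ M (2 * 1)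
        (integrationDeRhamIsoFamily (EuclideanSpace ℝ (Fin 4)) M (2 * 1) (deRhamCohomology.mk ⟨sf, hsf⟩))
        (singularHomology.map ℝ ℝ ⟨F, hF.continuous⟩ (2 * 1)
          (singularHomology.coeffChange (ComplexProjectiveSpace 1)
            (algebraMap ℤ ℝ : ℤ →+* ℝ).toAddMonoidHom (2 * 1) μP.fundamentalClass)) := by
    rw [← kroneckerPairing_map, ← integrationDeRhamIsoFamily_map_of_contMDiff hF (2 * 1),
      deRhamCohomology.map_mk]
  rw [hnat] at hpairP
  exact hpairP

end Summit.SmoothPoincare4.SmoothPoincare4.Theorems.GromovRecognitionRelEnd.CrossCapLaurent
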